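import Literature.IUT.HodgeArakelov.EtaleThetaDataOfSettingRootHypOfCor28i

/-!
# GAP row G-w5d169-2 (`hroot`), SUPPLIER ROUTE 2, COMPANION-FREE: `hroot` from [EtTh] Cor 2.8 (i) (F-0640
# `ThetaOrbitData.Cor28_i`) at the §1 model `ThetaOrbitData.ofEmbedding`, glued to the Π-INTRINSIC action of `Aut_top(Π^tp_X̲̲)`

S. Mochizuki, *The étale theta function …*, Publ. RIMS **45** (2009) [EtTh] (refereed): Def. 2.7 p. 41, Cor. 2.8 (i) p. 42
("`γ` … induces an automorphism of `Δ_Θ` … preserves the property that `η̲̈^{Θ,l·ℤ×μ₂}` be of standard type — a property that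
determines this collection of classes up to multiplication by a root of unity of order `l`"), Prop. 2.4 p. 38, Cor. 2.19 (iii)
p. 65 [cite: MochizukiEtTh2009, Cor 2.8(i) p.42]; S. Mochizuki, *Inter-universal Teichmüller theory II* (kurims, Dec. 2020),
Prop. 1.4 p. 27 / Prop. 3.4 (i) p. 91 (claim key `Mochizuki2012`, DISPUTED, D-0012) [cite: Mochizuki2012, Prop 1.4 p.27];
group cohomology bookkeeping [cite: NeukirchSchmidtWingberg2008, I §5].

abc-iut cell (block C / W6 seat abc-iut-w6-d051 gen 4; GAP-LEDGER row **G-w5d169-2**, SUPPLIER ROUTE 2 of the D-row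
2026-08-26T10:28:05Z; node IUTchII:Prop3.4(i), binder (P4) `hroot` of abc-iut-w5-d169).  PROOF-ONLY (0 def, no `Prop`-valued
definition, no named fact, no instance).  abc-iut-w5-d118's `EtaleThetaDataOfSettingRootHypOfCor28i` (p443943) closes the row
through a THETA COMPANION of an extension `γ ⊇ α` to `Π^tp_X` (abc-iut-w4-d041's `hE`-door; binders `range ι = T.tp T.PiX`,
`γ(Δ^tp_X) = Δ^tp_X`).  THIS file is the COMPANION-FREE twin: abc-iut-w5-d169's Π-intrinsic top action
`ρ^⊤_α = autActTopOfCor218i α` (`rangeAut α` on `φ(Π^tp_X̲̲)`) is compared DIRECTLY with the `(Γ, Γ_Θ)`-transport of [EtTh]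
Cor. 2.8, for `Γ ∈ Aut_top(Π^tp_C)` extending `α⁻¹` through `ι` ON `Π^tp_X̲̲` ONLY and `Γ_Θ` induced by `Γ` on the subquotient
`Δ_Θ` (Cor. 2.8 (i)'s own hypothesis `InducesOnTheta`).  With `cc := H¹(·, l·Δ_Θ) → H¹(·, Δ_Θ)`, `η̲̈ := rootLift C`:
1. `coeffChange_autActH1_rootLiftClass_eq_mk` — `cc (ρ_α η̲̈)` ON REPRESENTATIVES (a `Δ_Θ`-cocycle `F` on `Π^tp_Ÿ̲̲` with
   `F(x) = φ(α u)` whenever `φ u = η̲̈(α⁻¹ x)` represents it); `exists_rep_etaDd_restrict_eq_rootLift`.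
2. (`Π^tp_C` side) `OrbitEmbedding.exists_transport_rep_of_eqUpToRootOfUnity_rootLZMu2` — Cor. 2.8 (i)'s conclusion
   «`η̲̈^{Θ,l·ℤ×μ₂}` = its transport up to an `l`-th root of unity» UNPACKED at the (inhabited, abc-iut-L2-t2) root class of
   `η̈^Θ`: `l`-th powers kill the roots AND the `μ_l`-twist `κ` (`κ^l = ∂d`): `Γ_Θ⁻¹(F₀(Γ g)) = F'(g)·∂d(g)` on `Π^tp_Ÿ̲̲`.
3. (glue) `symm_coeffOf_phi_of_induces` (`Γ_Θ⁻¹ ∘ coeffOf = coeffOf ∘ rangeAut α` on `l·Δ_Θ`),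
   `phi_apply_eq_of_transport_identity` (pull-back along `ι` through abc-iut-L2-t2's `coeffOf_injective` / `act_coeffOf`),
   **`rootHyp_of_eqUpToRootOfUnity_ofEmbedding`** — `hroot` at `α`, via abc-iut-w4-d041's `rootHyp_of_coeffChange_eq`.
4. `exists_tower_extension_of_prop24` ((g1′): F-0609, `Π^tp_X̲̲`-clause, via abc-iut-w5-d118's `exists_continuousMulEquiv_Huu`)
   and **`rootHyp_of_cor28_i_intrinsic`** — `hroot` for every `α` from F-0609 + F-0640 BY NAME; residual binders:
   `IsOpenEmbedding ι`, `IsStandard`, `Dtau`-stability and `InducesOnTheta`-existence for tower-stabilising `Γ`, `hq`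
   (NO `range ι = T.tp T.PiX`, NO `γ(Δ^tp_X) = Δ^tp_X`, NO theta companion).
HONEST FRAMING: F-0609/F-0640 are FACT-LIST rows taken BY NAME (bare-interface ∀-closures schema-refuted, abc-iut-f-143
p435476 — irrelevant to instance forms at a genuine cover); nothing of [IUTchII] asserted; no side taken on [IUTchIII]
Cor. 3.12; typed ≠ proved.
-/

noncomputable section

open Topology

namespace Literature.AnabelianGeometry.EtaleTheta

open ThetaCovers

universe u

namespace ThetaSetting.EtaleThetaData.DoubleUnderline.OrbitEmbedding

variable {p : ℕ} [Fact p.Prime] {D : ThetaSetting p} {E : D.EtaleThetaData} {l : ℕ}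
  {C : E.DoubleUnderline l} {T : TemperedCoverData.{u} l} (ε : C.OrbitEmbedding T)

/-! ### 0. (`Π^tp_C` side) Cor 2.8 (i)'s conclusion unpacked at the root class of `η̈^Θ` -/

/-- `transport f (ι z) = coeffOf (f z)` for `z ∈ Π^tp_Ÿ` (`ι⁻¹ (ι z) = z`). [cite: MochizukiEtTh2009, Def 2.7 p.41] -/
theorem transport_apply_ι (f : ↥D.GtpYdd → ↥D.DeltaTheta) (z : ↥D.GtpYdd) (h : ε.ι z ∈ T.PiYddtp) :
    ε.transport f ⟨ε.ι z, h⟩ = ε.coeffOf (f z) :=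
  congrArg (fun t => ε.coeffOf (f t)) (ε.pull_ι z)

/-- **Unpacking «`η̲̈^{Θ,l·ℤ×μ₂}` agrees with its `(Γ, Γ_Θ)`-transport up to an `l`-th root of unity» (the conclusion shape
of [EtTh] Cor. 2.8 (i), conjunct 2, at `ofEmbedding ε hC hS`) at the root class of `η̈^Θ`, `l`-TH POWERS KILLING THE ROOTS**:
for a transported representative `F₀` of `η̈^Θ` whose values on `Π^tp_Ÿ̲̲` are `l`-th powers there are `σ ∈ Π^tp_X̲̲`, a
transported representative `F'` of `σ·η̈^Θ` and `d ∈ Δ_Θ` with `Γ_Θ⁻¹(F₀(Γ g)) = F'(g) · (g·d·g⁻¹·d⁻¹)` for all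
`g ∈ Π^tp_Ÿ̲̲` (of `T`) — the `μ_l`-twist `κ` of Cor. 2.8 (i) dies (`κ^l = ∂d`). [cite: MochizukiEtTh2009, Cor 2.8(i) p.42] -/
theorem exists_transport_rep_of_eqUpToRootOfUnity_rootLZMu2 [hN : D.GtpYdd.Normal] (hC : D.Compat)
    (hS : D.Sec2Hyps) {Γ : T.Gtp ≃ₜ* T.Gtp}
    (ΓΘ : (ThetaOrbitData.ofEmbedding ε hC hS).DeltaTheta ≃* (ThetaOrbitData.ofEmbedding ε hC hS).DeltaTheta)
    (hYuu : (T.PiYddtp ⊓ T.tp T.PiXuu).map Γ.toMulEquiv.toMonoidHom = T.PiYddtp ⊓ T.tp T.PiXuu)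
    (hE : (ThetaOrbitData.ofEmbedding ε hC hS).EqUpToRootOfUnity l _
      (ThetaOrbitData.ofEmbedding ε hC hS).rootLZMu2
      ((ThetaOrbitData.ofEmbedding ε hC hS).transport _ Γ hYuu ΓΘ (ThetaOrbitData.ofEmbedding ε hC hS).rootLZMu2))
    (F₀ : ↥T.PiYddtp → (ThetaOrbitData.ofEmbedding ε hC hS).DeltaTheta) (hF₀ : F₀ ∈ ε.classOf E.etaDd)
    (hpow : ∀ g : ↥(T.PiYddtp ⊓ T.tp T.PiXuu),
      ∃ r : (ThetaOrbitData.ofEmbedding ε hC hS).DeltaTheta, r ^ l = F₀ ⟨g, g.2.1⟩) :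
    ∃ σ ∈ C.Huu, ∃ F' : ↥T.PiYddtp → (ThetaOrbitData.ofEmbedding ε hC hS).DeltaTheta,
      F' ∈ ε.classOf (ContH1.conj D.toTheta D.DeltaTheta σ E.etaDd) ∧
      ∃ d : (ThetaOrbitData.ofEmbedding ε hC hS).DeltaTheta, ∀ g : ↥(T.PiYddtp ⊓ T.tp T.PiXuu),
        ΓΘ.symm (F₀ ⟨Γ g, (hYuu.le (Subgroup.mem_map.mpr ⟨g, g.2, rfl⟩)).1⟩) =
          F' ⟨g, g.2.1⟩ * ((ThetaOrbitData.ofEmbedding ε hC hS).act g d * d⁻¹) := by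
  obtain ⟨κ, -, -, ⟨d, hd⟩, hEq⟩ := hE
  have hmem : (fun ξ : ↥(T.PiYddtp ⊓ T.tp T.PiXuu) → (ThetaOrbitData.ofEmbedding ε hC hS).DeltaTheta =>
        fun g : ↥(T.PiYddtp ⊓ T.tp T.PiXuu) =>
          ΓΘ.symm (ξ ⟨Γ g, hYuu.le (Subgroup.mem_map.mpr ⟨g, g.2, rfl⟩)⟩)) '' ε.rootClassOf E.etaDd ∈
      (ThetaOrbitData.ofEmbedding ε hC hS).transport _ Γ hYuu ΓΘ (ThetaOrbitData.ofEmbedding ε hC hS).rootLZMu2 :=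
    ⟨ε.rootClassOf E.etaDd, ⟨1, C.Huu.one_mem, by rw [ContH1.conj_one_apply]⟩, rfl⟩
  rw [hEq] at hmem
  obtain ⟨c, ⟨σ, hσ, rfl⟩, hc⟩ := hmem
  dsimp only at hc
  choose r hr using hpow
  have hξ : (fun g => r g) ∈ ε.rootClassOf E.etaDd := ⟨F₀, hF₀, fun g => hr g⟩
  have hTξ : (fun g : ↥(T.PiYddtp ⊓ T.tp T.PiXuu) =>
        ΓΘ.symm (r ⟨Γ g, hYuu.le (Subgroup.mem_map.mpr ⟨g, g.2, rfl⟩)⟩)) ∈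
      (fun ξ : ↥(T.PiYddtp ⊓ T.tp T.PiXuu) → (ThetaOrbitData.ofEmbedding ε hC hS).DeltaTheta =>
        fun g : ↥(T.PiYddtp ⊓ T.tp T.PiXuu) => ξ g * κ g) ''
        ε.rootClassOf (ContH1.conj D.toTheta D.DeltaTheta σ E.etaDd) := by
    rw [hc]
    exact ⟨_, hξ, rfl⟩
  obtain ⟨ξ', ⟨F', hF', hξ'⟩, hξ'eq⟩ := hTξ
  refine ⟨σ, hσ, F', hF', d, fun g => ?_⟩
  have e1 := congrFun hξ'eq g
  dsimp only at e1
  rw [← hr ⟨Γ g, hYuu.le (Subgroup.mem_map.mpr ⟨g, g.2, rfl⟩)⟩, map_pow, ← e1,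
    Commute.mul_pow (ThetaOrbitData.ofEmbedding_deltaTheta_comm ε hC hS _ _) l, hd]
  erw [hξ' g]

end ThetaSetting.EtaleThetaData.DoubleUnderline.OrbitEmbedding

end Literature.AnabelianGeometry.EtaleTheta

namespace Literature.IUT.HodgeArakelov

namespace EtaleThetaDataOfSetting

open Literature.AnabelianGeometry.EtaleTheta (ContH1 contCocycles)
open Literature.AnabelianGeometry.EtaleTheta CohomologySystemOfContH1

variable {p : ℕ} [Fact p.Prime] {D : Literature.AnabelianGeometry.EtaleTheta.ThetaSetting p}
  {E : D.EtaleThetaData} {l : ℕ} (C : E.DoubleUnderline l) (hq : IsQuotientMap D.toTheta)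
  (α : (Pi C) ≃ₜ* (Pi C)) (hker : ∀ x, x ∈ (phi C).ker ↔ α x ∈ (phi C).ker)
  (hA : ∀ x, x ∈ (D.lDeltaTheta l).comap (phi C) ↔ α x ∈ (D.lDeltaTheta l).comap (phi C))
  (hH : ∀ x, x ∈ PiYdd C ↔ α x ∈ PiYdd C)

/-! ### 1. (§1 side) `cc (ρ_α η̲̈)` on representatives: a POINTWISE criterion -/

/-- **The `Δ_Θ`-image of `ρ_α η̲̈` on representatives.** `autActH1 α` is the pair transport `(α, rangeAut α)` read at
the restricted ambient `φ(Π^tp_X̲̲)`; on the chosen root cocycle `η̲̈ = rootLift` its value at `x ∈ Π^tp_Ÿ̲̲` is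
`φ(α u)` for ANY `u ∈ Π^tp_X̲̲` with `φ u = η̲̈(α⁻¹ x)` (`rangeAut (φ u) = φ (α u)`). Hence: a continuous `Δ_Θ`-cocycle
`F` on `Π^tp_Ÿ̲̲` taking these values represents `cc (autActH1 α η̲̈)`. [cite: Mochizuki2012, Prop 1.4 p.27] -/
theorem coeffChange_autActH1_rootLiftClass_eq_mk
    (F : ↥(PiYdd C ⊓ ⊤) → ↥D.DeltaTheta) (hF : F ∈ contCocycles (phi C) D.DeltaTheta (PiYdd C ⊓ ⊤))
    (hval : ∀ (x : ↥(PiYdd C ⊓ ⊤)) (u : Pi C),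
      phi C u = ((rootLift C).1 (toYdduu C ⊤ ⟨α.symm x, symm_mem_inf_top (PiYdd C) α hH x x.2⟩) : D.GtpTheta) →
      (F x : D.GtpTheta) = phi C (α u)) :
    ContH1.coeffChange (phi C) (D.lDeltaTheta_le l) (PiYdd C ⊓ ⊤) (autActH1 C hq α hker hA hH (rootLiftClass C)) =
      ContH1.mk F hF := by
  have e1 : autActH1 C hq α hker hA hH (rootLiftClass C) =
      (topRestrict C).symm (h1TopAut (phiR C) ((D.lDeltaTheta l).subgroupOf (phiRange C)) (PiYdd C) α
        (rangeAut C α hker hq) (rangeAut_phiR C α hker hq)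
        (fun a ha => (mem_lDeltaTheta_iff_rangeAut C α hker hq hA a).mp ha) hH (topRestrict C (rootLiftClass C))) := by
    rw [MulEquiv.eq_symm_apply, topRestrict_autActH1]
  rw [e1]
  change QuotientGroup.mk _ = QuotientGroup.mk _
  congr 1
  apply Subtype.ext; funext x; apply Subtype.ext
  obtain ⟨g, hg, hgu⟩ := Subgroup.mem_map.1 (lDeltaTheta_le_phiRange C
    (rootLift_val C (toYdduu C ⊤ ⟨α.symm x, symm_mem_inf_top (PiYdd C) α hH x x.2⟩)))
  have key : (⟨_, lDeltaTheta_le_phiRange C (rootLift_val C (toYdduu C ⊤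
      ⟨α.symm x, symm_mem_inf_top (PiYdd C) α hH x x.2⟩))⟩ : phiRange C) = phiR C ⟨g, hg⟩ := Subtype.ext hgu.symm
  exact (congrArg (fun t : phiRange C => ((rangeAut C α hker hq t : phiRange C) : D.GtpTheta)) key).trans
    ((coe_rangeAut_phiR C α hker hq ⟨g, hg⟩).trans (hval x ⟨g, hg⟩ hgu).symm)

/-! ### 2. (§1 side) a representative of `η̈^Θ` on `Π^tp_Ÿ` RESTRICTING to the chosen root cocycle `η̲̈` -/

/-- There is a continuous cocycle `f₀` on `Π^tp_Ÿ` representing `η̈^Θ` whose restriction to `Π^tp_Ÿ̲̲` IS the chosen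
`l·Δ_Θ`-valued root cocycle `η̲̈ = rootLift C` (correct any representative by the coboundary — defined on all of
`Π^tp_Ÿ` — by which its restriction differs from `η̲̈`). [cite: MochizukiEtTh2009, Def 2.7 p.41] -/
theorem exists_rep_etaDd_restrict_eq_rootLift :
    ∃ f₀ : ↥(contCocycles D.toTheta D.DeltaTheta D.GtpYdd), ContH1.mk f₀.1 f₀.2 = E.etaDd ∧
      ∀ y : ↥C.GtpYdduu, f₀.1 ⟨y, y.2.1⟩ = (rootLift C).1 y := by
  obtain ⟨f₁, hf₁⟩ := QuotientGroup.mk_surjective E.etaDd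
  have hres : (QuotientGroup.mk (ContH1.resCocycle D.toTheta D.DeltaTheta
        (inf_le_left : D.GtpYdd ⊓ C.Huu ≤ D.GtpYdd) f₁) : D.H1 (D.GtpYdd ⊓ C.Huu)) =
      QuotientGroup.mk (rootLift C) := by
    have h := rootLift_mk C
    rw [← hf₁] at h
    exact h.symm
  obtain ⟨a, ha⟩ := ContH1.exists_coboundary_of_mk_eq _ _ hres
  let c : ↥(contCocycles D.toTheta D.DeltaTheta D.GtpYdd) :=
    ⟨fun h : ↥D.GtpYdd => MulAut.conjNormal (D.toTheta (h : D.PiTemp)) a * a⁻¹,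
      Literature.AnabelianGeometry.EtaleTheta.ThetaSetting.EtaleThetaData.DoubleUnderline.coboundary_mem_contCocycles
        a D.GtpYdd⟩
  have hc : c ∈ (Literature.AnabelianGeometry.EtaleTheta.contCoboundaries D.toTheta D.DeltaTheta D.GtpYdd).subgroupOf
      (contCocycles D.toTheta D.DeltaTheta D.GtpYdd) :=
    Subgroup.mem_subgroupOf.2 ((Literature.AnabelianGeometry.EtaleTheta.mem_contCoboundaries_iff _).2 ⟨a, rfl⟩)
  refine ⟨f₁ * c, ?_, fun y => ?_⟩
  · rw [← hf₁]
    change (QuotientGroup.mk (f₁ * c) : D.H1 D.GtpYdd) = QuotientGroup.mk f₁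
    rw [QuotientGroup.mk_mul, (QuotientGroup.eq_one_iff c).2 hc, mul_one]
  · exact (ha y).symm

/-! ### 3. (glue) pulling the `Π^tp_C`-side identity back along `ι : Π^tp_X ↪ Π^tp_C` -/

section Glue

universe u

variable {T : ThetaCovers.TemperedCoverData.{u} l} (ε : C.OrbitEmbedding T)

/-- **`Γ_Θ` versus `rangeAut α` through the cyclotome comparison `coeffOf`.** If `Γ_Θ` is induced by `Γ` on the
cyclotome `ι(toTheta⁻¹Δ_Θ)/ι(Ker toTheta)` (`InducesOnTheta`) and `Γ` EXTENDS `α⁻¹` through `ι` (`Γ (ι x) = ι (α⁻¹ x)`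
on `Π^tp_X̲̲`), then `Γ_Θ⁻¹ (coeffOf (φ u)) = coeffOf (φ (α u))` for every `u ∈ Π^tp_X̲̲` with `φ u, φ (α u) ∈ Δ_Θ` — i.e.
`Γ_Θ⁻¹` is `rangeAut α` on `φ(Π^tp_X̲̲) ∩ Δ_Θ = l·Δ_Θ`. [cite: MochizukiEtTh2009, Cor 2.8(i) p.42] -/
theorem symm_coeffOf_phi_of_induces (hC : D.Compat) (hS : D.Sec2Hyps) {Γ : T.Gtp ≃ₜ* T.Gtp}
    (ΓΘ : (ThetaCovers.ThetaOrbitData.ofEmbedding ε hC hS).DeltaTheta ≃*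
      (ThetaCovers.ThetaOrbitData.ofEmbedding ε hC hS).DeltaTheta)
    (hind : (ThetaCovers.ThetaOrbitData.ofEmbedding ε hC hS).InducesOnTheta Γ ΓΘ)
    (hΓ : ∀ x : Pi C, Γ (ε.ι x) = ε.ι (α.symm x))
    (u : Pi C) (hu : phi C u ∈ D.DeltaTheta) (hαu : phi C (α u) ∈ D.DeltaTheta) :
    ΓΘ.symm (ε.coeffOf ⟨phi C u, hu⟩) = ε.coeffOf ⟨phi C (α u), hαu⟩ := by
  obtain ⟨hΓtop, hind'⟩ := hind
  have hmem : ε.ι ((α u : Pi C) : D.PiTemp) ∈ ε.top :=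
    Subgroup.mem_map.mpr ⟨_, Subgroup.mem_comap.mpr hαu, rfl⟩
  have hmem' : ε.ι ((u : Pi C) : D.PiTemp) ∈ ε.top :=
    Subgroup.mem_map.mpr ⟨_, Subgroup.mem_comap.mpr hu, rfl⟩
  rw [MulEquiv.symm_apply_eq, ε.coeffOf_eq_mk (d := ⟨phi C (α u), hαu⟩) rfl hmem,
    ε.coeffOf_eq_mk (d := ⟨phi C u, hu⟩) rfl hmem']
  refine ((hind' ⟨_, hmem⟩).trans ?_).symm
  congr 1
  apply Subtype.ext
  show Γ (ε.ι ((α u : Pi C) : D.PiTemp)) = ε.ι ((u : Pi C) : D.PiTemp)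
  rw [hΓ, ContinuousMulEquiv.symm_apply_apply]

include hA in
/-- **Pull-back along `ι` of the `Π^tp_C`-side identity** `Γ_Θ⁻¹(F₀(Γ g)) = F'(g)·(g·d·g⁻¹·d⁻¹)` (`F₀, F'` transports of
`f₀` (restricting to `η̲̈`) and `f'`, `d = coeffOf d₀`, `Γ ⊇ α⁻¹`, `Γ_Θ` induced): at `g = ι x` it reads, through abc-iut-L2-t2's
`coeffOf` (`coeffOf_injective`, `act_coeffOf`) and `symm_coeffOf_phi_of_induces`, `φ(α u) = f'(x)·(φ(x) d₀ φ(x)⁻¹ d₀⁻¹)` for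
any `u` with `φ u = η̲̈(α⁻¹ x)` — the pointwise datum of `coeffChange_autActH1_rootLiftClass_eq_mk`. [cite: MochizukiEtTh2009, Cor 2.8(i) p.42] -/
theorem phi_apply_eq_of_transport_identity (hC : D.Compat) (hS : D.Sec2Hyps) {Γ : T.Gtp ≃ₜ* T.Gtp}
    (ΓΘ : (ThetaCovers.ThetaOrbitData.ofEmbedding ε hC hS).DeltaTheta ≃*
      (ThetaCovers.ThetaOrbitData.ofEmbedding ε hC hS).DeltaTheta)
    (hind : (ThetaCovers.ThetaOrbitData.ofEmbedding ε hC hS).InducesOnTheta Γ ΓΘ)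
    (hΓ : ∀ x : Pi C, Γ (ε.ι x) = ε.ι (α.symm x))
    (hYuu : (T.PiYddtp ⊓ T.tp T.PiXuu).map Γ.toMulEquiv.toMonoidHom = T.PiYddtp ⊓ T.tp T.PiXuu)
    (f₀ : ↥(contCocycles D.toTheta D.DeltaTheta D.GtpYdd))
    (hf₀Y : ∀ y : ↥C.GtpYdduu, f₀.1 ⟨y, y.2.1⟩ = (rootLift C).1 y)
    (f' : ↥(contCocycles D.toTheta D.DeltaTheta D.GtpYdd)) (d₀ : ↥D.DeltaTheta)
    (F₀ F' : ↥T.PiYddtp → (ThetaCovers.ThetaOrbitData.ofEmbedding ε hC hS).DeltaTheta)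
    (hF₀ : F₀ = ε.transport f₀.1) (hF' : F' = ε.transport f'.1)
    (d : (ThetaCovers.ThetaOrbitData.ofEmbedding ε hC hS).DeltaTheta) (hd : d = ε.coeffOf d₀)
    (hId : ∀ g : ↥(T.PiYddtp ⊓ T.tp T.PiXuu),
      ΓΘ.symm (F₀ ⟨Γ g, (hYuu.le (Subgroup.mem_map.mpr ⟨g, g.2, rfl⟩)).1⟩) =
        F' ⟨g, g.2.1⟩ * ((ThetaCovers.ThetaOrbitData.ofEmbedding ε hC hS).act g d * d⁻¹))
    (x : ↥(PiYdd C ⊓ ⊤)) (u : Pi C)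
    (hu : phi C u = ((rootLift C).1 (toYdduu C ⊤ ⟨α.symm x, symm_mem_inf_top (PiYdd C) α hH x x.2⟩) :
      D.GtpTheta)) :
    phi C (α u) = ((f'.1 ⟨((x : Pi C) : D.PiTemp), (map_subtype_piYdd_inf_le_GtpYdd C ⊤) ⟨(x : Pi C), x.2, rfl⟩⟩ *
      (MulAut.conjNormal (phi C x) d₀ * d₀⁻¹) : ↥D.DeltaTheta) : D.GtpTheta) := by
  subst hF₀ hF' hd
  haveI : ε.bot.Normal := ε.normal_bot
  have hxY : ((x : Pi C) : D.PiTemp) ∈ D.GtpYdd := (map_subtype_piYdd_inf_le_GtpYdd C ⊤) ⟨(x : Pi C), x.2, rfl⟩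
  have hx' := symm_mem_inf_top (PiYdd C) α hH x x.2
  have hαxY : ((α.symm x : Pi C) : D.PiTemp) ∈ D.GtpYdd := (map_subtype_piYdd_inf_le_GtpYdd C ⊤) ⟨_, hx', rfl⟩
  have hαxYT : ε.ι ((α.symm x : Pi C) : D.PiTemp) ∈ T.PiYddtp := ε.map_GtpYdd.le ⟨_, hαxY, rfl⟩
  have hg : ε.ι ((x : Pi C) : D.PiTemp) ∈ T.PiYddtp ⊓ T.tp T.PiXuu :=
    ⟨ε.map_GtpYdd.le ⟨_, hxY, rfl⟩, ε.map_Huu.le ⟨_, (x : Pi C).2, rfl⟩⟩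
  have hu_mem : phi C u ∈ D.lDeltaTheta l := by rw [hu]; exact rootLift_val C _
  have hαu : phi C (α u) ∈ D.DeltaTheta := D.lDeltaTheta_le l ((hA u).mp hu_mem)
  have e0 : ε.transport f₀.1 ⟨Γ (ε.ι ((x : Pi C) : D.PiTemp)),
        (hYuu.le (Subgroup.mem_map.mpr ⟨_, hg, rfl⟩)).1⟩ =
      ε.coeffOf ⟨phi C u, D.lDeltaTheta_le l hu_mem⟩ :=
    calc ε.transport f₀.1 ⟨Γ (ε.ι ((x : Pi C) : D.PiTemp)), (hYuu.le (Subgroup.mem_map.mpr ⟨_, hg, rfl⟩)).1⟩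
        = ε.transport f₀.1 ⟨ε.ι ((α.symm x : Pi C) : D.PiTemp), hαxYT⟩ :=
          congrArg (ε.transport f₀.1) (Subtype.ext (hΓ x))
      _ = ε.coeffOf (f₀.1 ⟨_, hαxY⟩) := ε.transport_apply_ι f₀.1 ⟨_, hαxY⟩ hαxYT
      _ = ε.coeffOf ⟨phi C u, D.lDeltaTheta_le l hu_mem⟩ := by
          congr 1
          rw [hf₀Y ⟨_, ⟨hαxY, (α.symm x).2⟩⟩]
          exact Subtype.ext hu.symm
  have key := hId ⟨_, hg⟩
  rw [e0, symm_coeffOf_phi_of_induces C α ε hC hS ΓΘ hind hΓ u _ hαu, ε.transport_apply_ι f'.1 ⟨_, hxY⟩,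
    ε.act_coeffOf hC hS] at key
  have key' : ε.coeffOf ⟨phi C (α u), hαu⟩ = ε.coeffOf (f'.1 ⟨_, hxY⟩) *
      (ε.coeffOf (MulAut.conjNormal (D.toTheta ((x : Pi C) : D.PiTemp)) d₀) * (ε.coeffOf d₀)⁻¹) := key
  obtain ⟨e, he⟩ := ε.exists_mulEquiv_coeffOf
  simp only [← he] at key'
  rw [← map_inv e, ← map_mul e, ← map_mul e] at key'
  exact congrArg Subtype.val (e.injective key')

/-! ### 4. `hroot` FROM the conclusion of [EtTh] Cor 2.8 (i) (conjunct 2) for an extension `Γ ⊇ α⁻¹` -/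

/-- **ROUTE 2 GLUE (core)**: for `α ∈ Aut_top(Π^tp_X̲̲)` and `Γ ∈ Aut_top(Π^tp_C)` EXTENDING `α⁻¹` through `ι`
(`Γ (ι x) = ι (α⁻¹ x)`), stabilising `Π^tp_Ÿ̲̲` of `T` and inducing `Γ_Θ` on the cyclotome: if «`η̲̈^{Θ,l·ℤ×μ₂}` agrees with its
`(Γ, Γ_Θ)`-transport up to a root of unity of order `l`» — the conclusion of [EtTh] Cor. 2.8 (i) (F-0640, conjunct 2) at
`ofEmbedding ε hC hS` — then abc-iut-w5-d169's `hroot` holds at `α`: `ρ^⊤_α η̲̈ = conj_τ η̲̈ + ε'`, `l • ε' = 0`, `τ ∈ Π^tp_X̲̲`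
(§1–§3 + abc-iut-w4-d041's `rootHyp_of_coeffChange_eq`: the `μ_l`-indeterminacy is `Ker cc`). [cite: MochizukiEtTh2009, Cor 2.8(i) p.42] -/
theorem rootHyp_of_eqUpToRootOfUnity_ofEmbedding [(PiYdd C).Normal] [hN : D.GtpYdd.Normal] {N : ℕ+}
    (μ : D.CyclotomeMod l N) (hC : D.Compat) (hS : D.Sec2Hyps) (h15 : D.Prop15iii E hC) (L : C.CuspLabels)
    (R : RigidData.{0} N l) (hR : R = C.rigidData μ hC hS h15 L) (h218i : R.Cor218_i)
    {Γ : T.Gtp ≃ₜ* T.Gtp}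
    (ΓΘ : (ThetaCovers.ThetaOrbitData.ofEmbedding ε hC hS).DeltaTheta ≃*
      (ThetaCovers.ThetaOrbitData.ofEmbedding ε hC hS).DeltaTheta)
    (hind : (ThetaCovers.ThetaOrbitData.ofEmbedding ε hC hS).InducesOnTheta Γ ΓΘ)
    (hΓ : ∀ x : Pi C, Γ (ε.ι x) = ε.ι (α.symm x))
    (hYuu : (T.PiYddtp ⊓ T.tp T.PiXuu).map Γ.toMulEquiv.toMonoidHom = T.PiYddtp ⊓ T.tp T.PiXuu)
    (hE : (ThetaCovers.ThetaOrbitData.ofEmbedding ε hC hS).EqUpToRootOfUnity l _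
      (ThetaCovers.ThetaOrbitData.ofEmbedding ε hC hS).rootLZMu2
      ((ThetaCovers.ThetaOrbitData.ofEmbedding ε hC hS).transport _ Γ hYuu ΓΘ
        (ThetaCovers.ThetaOrbitData.ofEmbedding ε hC hS).rootLZMu2)) :
    ∃ τ : Pi C, ∃ ε' : (coh C).H1 ⊤, l • ε' = 0 ∧
      autActTopOfCor218i C hq μ hC hS h15 L R hR h218i α (rootTop C) =
        h1TopConjEquiv (phi C) (D.lDeltaTheta l) (PiYdd C) τ (rootTop C) + ε' := by
  haveI : ε.bot.Normal := ε.normal_bot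
  obtain ⟨f₀, hf₀, hf₀Y⟩ := exists_rep_etaDd_restrict_eq_rootLift C
  have hpow : ∀ g : ↥(T.PiYddtp ⊓ T.tp T.PiXuu),
      ∃ r : (ThetaCovers.ThetaOrbitData.ofEmbedding ε hC hS).DeltaTheta, r ^ l = ε.transport f₀.1 ⟨g, g.2.1⟩ := by
    intro g
    have hgY := ε.pull_mem_Huu g
    obtain ⟨y, hy, hyl⟩ := rootLift_val C ⟨_, hgY⟩
    obtain ⟨e, he⟩ := ε.exists_mulEquiv_coeffOf
    refine ⟨ε.coeffOf ⟨y, hy⟩, ?_⟩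
    show ε.coeffOf ⟨y, hy⟩ ^ l = ε.coeffOf (f₀.1 (ε.pull ⟨g, g.2.1⟩))
    have hv : f₀.1 (ε.pull ⟨g, g.2.1⟩) = ⟨y, hy⟩ ^ l :=
      (hf₀Y ⟨_, hgY⟩).trans (Subtype.ext (by rw [SubmonoidClass.coe_pow]; exact hyl.symm))
    rw [hv, ← he, ← he, map_pow]
  obtain ⟨σ, hσ, F', hF', d, hId⟩ := ε.exists_transport_rep_of_eqUpToRootOfUnity_rootLZMu2 hC hS ΓΘ hYuu hE
    (ε.transport f₀.1) ⟨f₀, hf₀, rfl⟩ hpow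
  obtain ⟨f', hf', rfl⟩ := hF'
  obtain ⟨d₀, rfl⟩ := ε.coeffOf_surjective d
  let c : ↥(contCocycles D.toTheta D.DeltaTheta D.GtpYdd) :=
    ⟨fun h : ↥D.GtpYdd => MulAut.conjNormal (D.toTheta (h : D.PiTemp)) d₀ * d₀⁻¹,
      Literature.AnabelianGeometry.EtaleTheta.ThetaSetting.EtaleThetaData.DoubleUnderline.coboundary_mem_contCocycles
        d₀ D.GtpYdd⟩
  have hF := (ContH1.comapCocycle D.toTheta D.DeltaTheta C.Huu.subtype continuous_subtype_val
    (map_subtype_piYdd_inf_le_GtpYdd C ⊤) (f' * c)).2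
  have h3 := coeffChange_autActH1_rootLiftClass_eq_mk C hq α
    (mem_ker_phi_iff_of_cor218_i C μ hC hS h15 L R hR h218i α)
    (mem_comap_lDeltaTheta_iff_of_cor218_i C μ hC hS h15 L R hR h218i α)
    (mem_PiYdd_iff_of_cor218_i C μ hC hS h15 L R hR h218i α) _ hF (fun x u hu =>
      (phi_apply_eq_of_transport_identity C α (mem_comap_lDeltaTheta_iff_of_cor218_i C μ hC hS h15 L R hR h218i α)
        (mem_PiYdd_iff_of_cor218_i C μ hC hS h15 L R hR h218i α) ε hC hS ΓΘ hind hΓ hYuu f₀ hf₀Y f' d₀ _ _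
        rfl rfl _ rfl hId x u hu).symm)
  have hc1 : ContH1.mk (f' * c).1 (f' * c).2 = ContH1.conj D.toTheta D.DeltaTheta σ E.etaDd := by
    rw [← hf']
    change (QuotientGroup.mk (f' * c) : D.H1 D.GtpYdd) = QuotientGroup.mk f'
    rw [QuotientGroup.mk_mul, (QuotientGroup.eq_one_iff c).2 (Subgroup.mem_subgroupOf.2
      ((Literature.AnabelianGeometry.EtaleTheta.mem_contCoboundaries_iff _).2 ⟨d₀, rfl⟩)), mul_one]
  have hmkF : ContH1.mk _ hF = ContH1.comap D.toTheta D.DeltaTheta C.Huu.subtype continuous_subtype_val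
      (map_subtype_piYdd_inf_le_GtpYdd C ⊤) (ContH1.conj D.toTheta D.DeltaTheta σ E.etaDd) := by
    rw [← hc1]
    rfl
  refine rootHyp_of_coeffChange_eq C hq μ hC hS h15 L R hR h218i α ⟨σ, hσ⟩ ?_
  rw [← ContH1.conj_coeffChange, conj_coeffChange_rootLiftClass]
  unfold autActTopOfCor218i rootTop
  rw [autActTop_h1Top_symm, AddEquiv.apply_symm_apply, toMul_ofMul, toMul_ofMul, h3, hmkF]

/-! ### 5. With F-0609 `Prop24` and F-0640 `Cor28_i` BY NAME: the companion-free Route-2 closer -/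

/-- **(g1′) Extension by [EtTh] Prop 2.4, `Π^tp_X̲̲`-clause only**: granted the NAMED FACT F-0609 `T.Prop24`, every
`α ∈ Aut_top(Π^tp_X̲̲)` is the restriction THROUGH `ι` of some `Γ ∈ Aut_top(Π^tp_C)` stabilising the Prop 2.4 tower —
`Γ (ι x) = ι (α x)` on `Π^tp_X̲̲` (abc-iut-w5-d118's `exists_continuousMulEquiv_Huu` transports `α` to `T.tp T.PiXuu`; unlike
`exists_extension_of_prop24` no restriction to the whole of `Π^tp_X`, hence no `range ι = T.tp T.PiX`, is needed here).
[cite: MochizukiEtTh2009, Prop 2.4 p.38] -/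
theorem exists_tower_extension_of_prop24 (hιe : IsOpenEmbedding ε.ι) (h24 : T.Prop24) (β : (Pi C) ≃ₜ* (Pi C)) :
    ∃ Γ : T.Gtp ≃ₜ* T.Gtp, (∀ S ∈ T.tower, S.map Γ.toMulEquiv.toMonoidHom = S) ∧
      ∀ x : Pi C, Γ (ε.ι x) = ε.ι (β x) := by
  obtain ⟨eU, heU⟩ := exists_continuousMulEquiv_Huu C ε hιe
  obtain ⟨Γ, hΓext, hΓtower⟩ := h24.1 (eU.symm.trans ((show ↥C.Huu ≃ₜ* ↥C.Huu from β).trans eU))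
  refine ⟨Γ, hΓtower, fun x => ?_⟩
  have hx : eU.symm ⟨ε.ι (x : D.PiTemp), ε.map_Huu.le ⟨x, x.2, rfl⟩⟩ = (x : ↥C.Huu) := by
    apply eU.injective
    rw [ContinuousMulEquiv.apply_symm_apply]
    exact Subtype.ext (heU x).symm
  have h1 := hΓext ⟨ε.ι (x : D.PiTemp), ε.map_Huu.le ⟨x, x.2, rfl⟩⟩
  rw [show Γ (ε.ι x) = Γ ((⟨ε.ι (x : D.PiTemp), ε.map_Huu.le ⟨x, x.2, rfl⟩⟩ : ↥(T.tp T.PiXuu)) : T.Gtp)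
    from rfl, h1]
  show ((eU (β (eU.symm ⟨ε.ι (x : D.PiTemp), _⟩)) : ↥(T.tp T.PiXuu)) : T.Gtp) = ε.ι ((β x : Pi C) : D.PiTemp)
  rw [hx, heU]

/-- **G-w5d169-2 CLOSED ALONG ROUTE 2, COMPANION-FREE VARIANT**: abc-iut-w5-d169's `hroot` — «every topological
automorphism `α` of `Π^tp_X̲̲` carries `η̲̈^Θ ∈ H¹(Π^tp_Ÿ̲̲, l·Δ_Θ)` to a `Π^tp_X̲̲`-conjugate up to an `l`-torsion class» — from the
NAMED FACTS F-0609 `T.Prop24` and F-0640 `Cor28_i` at `ofEmbedding ε hC hS`, under: `ι` an open embedding, standard type,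
tower-stabilising automorphisms of `Π^tp_C` permute `Dtau` ("`γ` maps `τ` to `τ^{±1}`") and INDUCE an automorphism of
the subquotient `Δ_Θ` (`hInd`; Cor 2.8 (i): "`γ` … induces an automorphism of `Δ_Θ`"), and `hq` — no `range ι = T.tp T.PiX`,
no `γ(Δ^tp_X) = Δ^tp_X`, no theta companion (`hInd` follows from those two via abc-iut-w5-d118's
`exists_inducesOnTheta_of_companion`). [cite: MochizukiEtTh2009, Cor 2.8(i) p.42] -/
theorem rootHyp_of_cor28_i_intrinsic [(PiYdd C).Normal] [hN : D.GtpYdd.Normal] {N : ℕ+}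
    (μ : D.CyclotomeMod l N) (hC : D.Compat) (hS : D.Sec2Hyps) (h15 : D.Prop15iii E hC) (L : C.CuspLabels)
    (R : RigidData.{0} N l) (hR : R = C.rigidData μ hC hS h15 L) (h218i : R.Cor218_i)
    (hιe : IsOpenEmbedding ε.ι) (h24 : T.Prop24)
    (hstd : (ThetaCovers.ThetaOrbitData.ofEmbedding ε hC hS).IsStandard)
    (h28 : (ThetaCovers.ThetaOrbitData.ofEmbedding ε hC hS).Cor28_i)
    (hDtau : ∀ Γ : T.Gtp ≃ₜ* T.Gtp, (∀ S ∈ T.tower, S.map Γ.toMulEquiv.toMonoidHom = S) →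
      ∀ Dt ∈ (ThetaCovers.ThetaOrbitData.ofEmbedding ε hC hS).Dtau,
        Dt.map Γ.toMulEquiv.toMonoidHom ∈ (ThetaCovers.ThetaOrbitData.ofEmbedding ε hC hS).Dtau)
    (hInd : ∀ Γ : T.Gtp ≃ₜ* T.Gtp, (∀ S ∈ T.tower, S.map Γ.toMulEquiv.toMonoidHom = S) →
      ∃ ΓΘ : (ThetaCovers.ThetaOrbitData.ofEmbedding ε hC hS).DeltaTheta ≃*
        (ThetaCovers.ThetaOrbitData.ofEmbedding ε hC hS).DeltaTheta,
        (ThetaCovers.ThetaOrbitData.ofEmbedding ε hC hS).InducesOnTheta Γ ΓΘ) :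
    ∃ τ : Pi C, ∃ ε' : (coh C).H1 ⊤, l • ε' = 0 ∧
      autActTopOfCor218i C hq μ hC hS h15 L R hR h218i α (rootTop C) =
        h1TopConjEquiv (phi C) (D.lDeltaTheta l) (PiYdd C) τ (rootTop C) + ε' := by
  obtain ⟨Γ, hΓtower, hΓ⟩ := exists_tower_extension_of_prop24 C ε hιe h24 α.symm
  obtain ⟨ΓΘ, hind⟩ := hInd Γ hΓtower
  have hY : T.PiYddtp.map Γ.toMulEquiv.toMonoidHom = T.PiYddtp :=
    hΓtower _ (by simp [ThetaCovers.TemperedCoverData.tower])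
  have hU : (T.tp T.PiXuu).map Γ.toMulEquiv.toMonoidHom = T.tp T.PiXuu :=
    hΓtower _ (by simp [ThetaCovers.TemperedCoverData.tower])
  have hYuu := ThetaSetting.EtaleThetaData.DoubleUnderline.OrbitEmbedding.map_PiYdduu_eq hY hU
  exact rootHyp_of_eqUpToRootOfUnity_ofEmbedding C hq α ε μ hC hS h15 L R hR h218i ΓΘ hind hΓ hYuu
    ((h28 hstd Γ ΓΘ hind (hDtau Γ hΓtower) hY hYuu).2.1 hΓtower)

end Glue

end EtaleThetaDataOfSetting

end Literature.IUT.HodgeArakelov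

end
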